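import Mathlib
import Summits.Ventures.YMGap.FlowData.RitzDeflationCertificate
import Summits.Ventures.YMGap.FlowData.SymmetryBlockMerge
import Summits.Ventures.YMGap.FlowData.RelativeKineticTailCertificate

/-!
# Venture YMGap, track Y3 FLOW-DATA — the RELATIVE kinetic-tail certificate («TAIL-R») of lineage A, part 2: the level bound

HONEST FRAMING: venture file of the cell `pub-ymgap` (QuantumFields programme), track Y3.  Finite real linear
algebra only; nothing here is a statement about Yang–Mills, a continuum limit or a mass gap.

Continuation of `RelativeKineticTailCertificate.lean` (the Loewner-order inequalities `block_domination`,
`offDiag_sq_le`, `corner_le`).  With `P` the diagonal projector onto the kept coordinates, `Q = 1 − P`, `S = D V D`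
(`D = diag(d)`, `V` symmetric, `V ⪯ Ω·1`), `d_i² ≤ κ` off the kept set and `δ > 0`:

* `eigenvalues₀_le_max_of_supported`: for `A = P A P` and `θ ≥ 0`, `λ↓_k(A + θ Q) ≤ max(λ↓_k(A), θ)` for EVERY
                       level `k` (min–max against the head eigenvectors of `A`, which lie in `range P`);
* ★ `tailR_level_bound`: if the engine's (padded) matrix `A'` dominates `P S P + (κ/δ) P D V Q V D P` and is
                       supported on the kept set, then `λ↓_k(S) ≤ max(λ↓_k(A'), κ Ω + δ)` for every `k` — the
                       `T_hi_R` of a v2.4 task JSON before the float certificate of `λ↓_k(A')` (`RitzDeflation`).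

* `sq_normWeight_eq` / `prod_sq_normWeight_le`: the pointwise `2β`-build domination of the second moment,
                       `Π_p (e^{b a_p}/c₀(β))² ≤ m₂^N Π_p (u_p + τ′)` with `m₂ = c₀(2β)/c₀(β)²` (ENGINE.md §10.1 (2)).

EFFECT (ENGINE.md §10.1): the kinetic-tail peak `Ω = R^{N_sp}` no longer enters the precision of a certified level but
only the yes/no THRESHOLD `κ Ω + δ < λ↓_k`; the precision is the plaquette bracket.  Mathlib's antitone enumeration
`Matrix.IsHermitian.eigenvalues₀`; min–max tools from `BlockMerge` / `Literature.Analysis.InnerProduct`.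

References: R. A. Horn, C. R. Johnson, *Matrix Analysis*, 2nd ed. (2013), Thm. 4.2.6 (Courant–Fischer), Cor. 4.3.12
[cite: HornJohnson2013, Thm 4.2.6; Cor 4.3.12]; the cell's HOME/pub-ymgap-flow-eng-1/ENGINE.md §10 (2026-08-24).
-/

noncomputable section

open Matrix Finset WithLp Module
open scoped InnerProductSpace BigOperators

namespace Summit.Ventures.YMGap.FlowData

namespace RelativeKineticTail

open RitzDeflation BlockMerge
open Literature.Analysis.InnerProduct

variable {m : Type*} [Fintype m] [DecidableEq m]


/-! ### §1 Threshold merge (min–max) -/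

omit [DecidableEq m] in
/-- Real inner products on `EuclideanSpace ℝ m` are dot products. [folklore] -/
theorem inner_eq_dotProduct (x y : EuclideanSpace ℝ m) : ⟪x, y⟫_ℝ = ofLp x ⬝ᵥ ofLp y := by
  rw [EuclideanSpace.inner_eq_star_dotProduct, star_trivial, dotProduct_comm]

/-- The quadratic form of `toEuclideanLin M` is the matrix quadratic form. [folklore] -/
theorem inner_toEuclideanLin_self (M : Matrix m m ℝ) (x : EuclideanSpace ℝ m) :
    ⟪toEuclideanLin M x, x⟫_ℝ = ofLp x ⬝ᵥ (M *ᵥ ofLp x) := by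
  rw [real_inner_comm, inner_eq_dotProduct]; rfl

omit [DecidableEq m] in
/-- A real symmetric matrix moves across the dot product. [folklore] -/
theorem mulVec_dotProduct_of_isHermitian {P : Matrix m m ℝ} (hP : P.IsHermitian) (v w : m → ℝ) :
    (P *ᵥ v) ⬝ᵥ w = v ⬝ᵥ (P *ᵥ w) := by
  have hPT : Pᵀ = P := by
    have h := hP.eq
    rwa [conjTranspose_eq_transpose_of_trivial] at h
  rw [← vecMul_transpose, hPT, dotProduct_mulVec]

/-- ★ **Threshold merge.** If the symmetric `A` is supported on the kept set (`P A P = A` for a symmetric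
idempotent `P`) and `0 ≤ θ`, then for EVERY level `k`: `λ↓_k(A + θ (1 − P)) ≤ max(λ↓_k(A), θ)` — the spectrum of
`A ⊕ θ·1_{Q}` is the union of the two, and its `k`-th largest member is at most the larger of `λ↓_k(A)` and `θ`.
Proof: min–max against the `k` head eigenvectors of `A` (they lie in `range P` when `λ↓_k(A) > 0`).
[cite: HornJohnson2013, Thm 4.2.6] -/
theorem eigenvalues₀_le_max_of_supported {A P : Matrix m m ℝ} (hA : A.IsHermitian) (hP : P.IsHermitian)
    (hP2 : P * P = P) (hAP : P * A * P = A) {θ : ℝ} (hθ : 0 ≤ θ)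
    (hAθ : (A + θ • (1 - P)).IsHermitian) (k : Fin (Fintype.card m)) :
    hAθ.eigenvalues₀ k ≤ max (hA.eigenvalues₀ k) θ := by
  classical
  have hS : (toEuclideanLin (A + θ • (1 - P))).IsSymmetric := isSymmetric_toEuclideanLin_iff.mpr hAθ
  have hSA : (toEuclideanLin A).IsSymmetric := isSymmetric_toEuclideanLin_iff.mpr hA
  change hS.eigenvalues finrank_euclideanSpace k ≤ max (hSA.eigenvalues finrank_euclideanSpace k) θ
  obtain ⟨lam, hlam⟩ : ∃ lam : ℝ, hSA.eigenvalues finrank_euclideanSpace k = lam := ⟨_, rfl⟩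
  obtain ⟨c, hc⟩ : ∃ c : ℝ, max lam θ = c := ⟨_, rfl⟩
  rw [hlam, hc]
  have hlamc : lam ≤ c := by rw [← hc]; exact le_max_left _ _
  have hθc : θ ≤ c := by rw [← hc]; exact le_max_right _ _
  -- matrix facts
  have hPA : P * A = A := by
    calc P * A = P * (P * A * P) := by rw [hAP]
      _ = (P * P) * A * P := by simp only [Matrix.mul_assoc]
      _ = A := by rw [hP2, hAP]
  -- the head eigenvectors of `A`
  let e : Fin (Fintype.card m) → EuclideanSpace ℝ m := fun l => hSA.eigenvectorBasis finrank_euclideanSpace l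
  have heig : ∀ l : Fin (Fintype.card m),
      A *ᵥ ofLp (e l) = hSA.eigenvalues finrank_euclideanSpace l • ofLp (e l) := by
    intro l
    have h := hSA.apply_eigenvectorBasis finrank_euclideanSpace l
    rw [RCLike.ofReal_real_eq_id, id_eq] at h
    exact congrArg (fun z : EuclideanSpace ℝ m => ofLp z) h
  -- eigenvectors with non-zero eigenvalue lie in `range P`
  have hPe : ∀ l : Fin (Fintype.card m),
      hSA.eigenvalues finrank_euclideanSpace l ≠ 0 → P *ᵥ ofLp (e l) = ofLp (e l) := by
    intro l hl
    have h1 : P *ᵥ (A *ᵥ ofLp (e l)) = A *ᵥ ofLp (e l) := by rw [mulVec_mulVec, hPA]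
    rw [heig l, mulVec_smul] at h1
    exact smul_right_injective _ hl h1
  -- the constraint family: `e_l`, `l < k`
  let κ := {l : Fin (Fintype.card m) // (l : ℕ) < (k : ℕ)}
  let v : κ → EuclideanSpace ℝ m := fun q => e q.1
  have hcard : Fintype.card κ ≤ (k : ℕ) := by
    have hinj : Function.Injective (fun q : κ => (⟨q.1, q.2⟩ : Fin k)) := by
      intro a b hab
      exact Subtype.ext (Fin.ext (by simpa using congrArg Fin.val hab))
    simpa using Fintype.card_le_of_injective _ hinj
  refine eigenvalues_le_of_forall_orthogonal_family hS finrank_euclideanSpace v ?_ k hcard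
  intro x hx
  rw [RCLike.re_to_real]
  -- coordinates
  set w : m → ℝ := ofLp x with hw
  set α : ℝ := w ⬝ᵥ (A *ᵥ w) with hα
  set π : ℝ := w ⬝ᵥ (P *ᵥ w) with hπ
  set ν : ℝ := w ⬝ᵥ w with hν
  have hνx : ‖x‖ ^ 2 = ν := by rw [← real_inner_self_eq_norm_sq, inner_eq_dotProduct]
  have hform : ⟪toEuclideanLin (A + θ • (1 - P)) x, x⟫_ℝ = α + θ * (ν - π) := by
    rw [inner_toEuclideanLin_self, add_mulVec, smul_mulVec, sub_mulVec, one_mulVec, dotProduct_add,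
      dotProduct_smul, dotProduct_sub, smul_eq_mul]
  -- π = ‖P x‖², ν − π = ‖x − P x‖² ≥ 0
  have hPP : ∀ u : m → ℝ, (P *ᵥ u) ⬝ᵥ (P *ᵥ u) = u ⬝ᵥ (P *ᵥ u) := by
    intro u; rw [mulVec_dotProduct_of_isHermitian hP, mulVec_mulVec, hP2]
  have hπ0 : 0 ≤ π := by
    rw [hπ, ← hPP]; exact dotProduct_star_self_nonneg _
  have hνπ : 0 ≤ ν - π := by
    have h0 : 0 ≤ (w - P *ᵥ w) ⬝ᵥ (w - P *ᵥ w) := dotProduct_star_self_nonneg _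
    have h1 : (w - P *ᵥ w) ⬝ᵥ (w - P *ᵥ w) = ν - π := by
      rw [sub_dotProduct, dotProduct_sub, dotProduct_sub, hPP, mulVec_dotProduct_of_isHermitian hP]
      ring
    linarith
  -- the quadratic form of A through P x
  set y : EuclideanSpace ℝ m := toEuclideanLin P x with hy
  have hyw : ofLp y = P *ᵥ w := rfl
  have hyn : ‖y‖ ^ 2 = π := by
    rw [← real_inner_self_eq_norm_sq, inner_eq_dotProduct, hyw, hPP]
  have hAy : ⟪toEuclideanLin A y, y⟫_ℝ = α := by
    rw [inner_toEuclideanLin_self, hyw, mulVec_mulVec, mulVec_dotProduct_of_isHermitian hP, mulVec_mulVec,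
      ← Matrix.mul_assoc, hAP]
  -- orthogonality of x to the head (given) and of P x to the head (when the head eigenvalues are non-zero)
  have hx' : ∀ l : Fin (Fintype.card m), (l : ℕ) < (k : ℕ) → ⟪e l, x⟫_ℝ = 0 := fun l hl => hx ⟨l, hl⟩
  by_cases hpos : 0 < lam
  · have hy' : ∀ l : Fin (Fintype.card m), (l : ℕ) < (k : ℕ) → ⟪e l, y⟫_ℝ = 0 := by
      intro l hl
      have hle : lam ≤ hSA.eigenvalues finrank_euclideanSpace l := by
        rw [← hlam]; exact hSA.eigenvalues_antitone finrank_euclideanSpace (Fin.le_def.mpr hl.le)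
      have hne : hSA.eigenvalues finrank_euclideanSpace l ≠ 0 := by linarith
      rw [inner_eq_dotProduct, hyw, ← mulVec_dotProduct_of_isHermitian hP, hPe l hne, ← inner_eq_dotProduct]
      exact hx' l hl
    have hmm := re_inner_le_of_orthogonal_head hSA finrank_euclideanSpace (k : ℕ) (c := lam)
      (fun h => by rw [Fin.eta, hlam]) hy'
    rw [RCLike.re_to_real, hAy, hyn] at hmm
    have h1 : lam * π ≤ c * π := mul_le_mul_of_nonneg_right hlamc hπ0
    have h2 : θ * (ν - π) ≤ c * (ν - π) := mul_le_mul_of_nonneg_right hθc hνπ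
    rw [hform, hνx]
    linarith
  · have hmm := re_inner_le_of_orthogonal_head hSA finrank_euclideanSpace (k : ℕ) (c := lam)
      (fun h => by rw [Fin.eta, hlam]) hx'
    rw [RCLike.re_to_real, inner_toEuclideanLin_self] at hmm
    have hν0 : 0 ≤ ν := by rw [hν]; exact dotProduct_star_self_nonneg _
    have hαle : α ≤ 0 := by
      have : lam * ‖x‖ ^ 2 ≤ 0 := mul_nonpos_of_nonpos_of_nonneg (not_lt.mp hpos) (sq_nonneg _)
      exact hmm.trans this
    have h2 : θ * (ν - π) ≤ θ * ν := mul_le_mul_of_nonneg_left (by linarith) hθ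
    have h3 : θ * ν ≤ c * ν := mul_le_mul_of_nonneg_right hθc hν0
    rw [hform, hνx]
    linarith

/-! ### §2 The TAIL-R level bound -/

/-- ★ **TAIL-R level bound** (ENGINE.md §10.1–10.2, the shape the engine certifies).  `S = D V D` with
`D = diag d` (`d = √K ≥ 0` componentwise is not even needed), `V` symmetric with `V ⪯ Ω·1`, the kept projector
`P = diag[p]`, `Q = 1 − P`, `d_i² ≤ κ` off the kept set, `δ > 0`, and a symmetric matrix `A'` SUPPORTED on the
kept set that dominates `P S P + (κ/δ) · P D V Q V D P` (the engine's padded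
`A_δ = Gup + (κ_T/δ)[(1+(s⁻¹−1)η²) m2^N G′⁺ − (1−s) F̃F̃ᴴ]`, via `offDiag_split` + `gram_lower` + the `2β`-build
domination).  Then `λ↓_k(S) ≤ max(λ↓_k(A'), κ Ω + δ)` for EVERY level `k`.
[cite: HornJohnson2013, Thm 4.2.6; Cor 4.3.12] -/
theorem tailR_level_bound (p : m → Prop) [DecidablePred p] {V : Matrix m m ℝ} (hV : V.IsHermitian)
    (d : m → ℝ) {κ Ω δ : ℝ} (hδ : 0 < δ) (hκ0 : 0 ≤ κ) (hκ : ∀ i, ¬ p i → d i * d i ≤ κ) (hΩ : 0 ≤ Ω)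
    (hVΩ : (Ω • (1 : Matrix m m ℝ) - V).PosSemidef)
    (hS : (diagonal d * V * diagonal d).IsHermitian)
    {A' : Matrix m m ℝ} (hA' : A'.IsHermitian)
    (hsupp : (diagonal fun i => if p i then (1 : ℝ) else 0) * A' * (diagonal fun i => if p i then (1 : ℝ) else 0) = A')
    (hdom : (A' - ((diagonal fun i => if p i then (1 : ℝ) else 0) * (diagonal d * V * diagonal d) *
              (diagonal fun i => if p i then (1 : ℝ) else 0)
            + (κ / δ) • ((diagonal fun i => if p i then (1 : ℝ) else 0) * diagonal d * V *
              (1 - diagonal fun i => if p i then (1 : ℝ) else 0) * V * diagonal d *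
              (diagonal fun i => if p i then (1 : ℝ) else 0)))).PosSemidef)
    (k : Fin (Fintype.card m)) :
    hS.eigenvalues₀ k ≤ max (hA'.eigenvalues₀ k) (κ * Ω + δ) := by
  set P : Matrix m m ℝ := diagonal fun i => if p i then (1 : ℝ) else 0 with hPdef
  set D : Matrix m m ℝ := diagonal d with hDdef
  set S : Matrix m m ℝ := D * V * D with hSdef
  have hPh : P.IsHermitian := by rw [hPdef]; exact isHermitian_keptProj p
  have hP2 : P * P = P := by rw [hPdef]; exact keptProj_mul_self p
  have hθ : 0 ≤ κ * Ω + δ := by positivity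
  -- (1) block domination, (2) off-diagonal square bound, (3) corner bound
  have h1 := block_domination hS hPh hP2 hδ
  have h2 : (κ • (P * D * V * (1 - P) * V * D * P) - P * S * (1 - P) * S * P).PosSemidef := by
    rw [hPdef, hDdef, hSdef]; exact offDiag_sq_le p hV d hκ
  have h3 : ((κ * Ω) • (1 - P) - (1 - P) * S * (1 - P)).PosSemidef := by
    rw [hPdef, hSdef, hDdef]; exact corner_le p V d hκ hΩ hVΩ
  -- assemble:  A' + (κ Ω + δ) Q − S ⪰ 0
  have hδinv : 0 ≤ δ⁻¹ := inv_nonneg.mpr hδ.le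
  have h2' : (δ⁻¹ • (κ • (P * D * V * (1 - P) * V * D * P)) - δ⁻¹ • (P * S * (1 - P) * S * P)).PosSemidef := by
    rw [← smul_sub]; exact h2.smul hδinv
  have hsum := ((hdom.add h1).add h2').add h3
  have hAQ : (A' + (κ * Ω + δ) • (1 - P)).IsHermitian :=
    hA'.add (Matrix.IsHermitian.smul (isHermitian_one_sub hPh) (IsSelfAdjoint.all _))
  have key : A' + (κ * Ω + δ) • (1 - P) - S
      = (A' - (P * S * P + (κ / δ) • (P * D * V * (1 - P) * V * D * P)))
        + (P * S * P + δ⁻¹ • (P * S * (1 - P) * S * P) + (1 - P) * S * (1 - P) + δ • (1 - P) - S)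
        + (δ⁻¹ • (κ • (P * D * V * (1 - P) * V * D * P)) - δ⁻¹ • (P * S * (1 - P) * S * P))
        + ((κ * Ω) • (1 - P) - (1 - P) * S * (1 - P)) := by
    rw [smul_smul, div_eq_inv_mul, add_smul]
    abel
  have hle : (A' + (κ * Ω + δ) • (1 - P) - S).PosSemidef := by rw [key]; exact hsum
  -- eigenvalue monotonicity, then the threshold merge
  have hmono := eigenvalues₀_mono hS hAQ hle k
  have hmerge := eigenvalues₀_le_max_of_supported hA' hPh hP2 hsupp hθ hAQ k
  exact hmono.trans hmerge

/-! ### §3 The `2β`-build domination of the second moment (ENGINE.md §10.1 (2): `(W²)_S ⪯ m₂^N · G′⁺(2β)`) -/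

omit [Fintype m] [DecidableEq m] in
/-- The square of the normalised plaquette weight is `m₂` times the normalised weight at DOUBLED coupling:
`(e^{b a}/c)² = (c₂/c²) · (e^{2b a}/c₂)` (`c = c₀(β)`, `c₂ = c₀(2β)`, `m₂ = c₀(2β)/c₀(β)²`). [folklore] -/
theorem sq_normWeight_eq (b c c₂ a : ℝ) (hc : c ≠ 0) (hc₂ : c₂ ≠ 0) :
    (Real.exp (b * a) / c) ^ 2 = (c₂ / c ^ 2) * (Real.exp (2 * b * a) / c₂) := by
  have h : Real.exp (b * a) ^ 2 = Real.exp (2 * b * a) := by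
    rw [sq, ← Real.exp_add]; ring_nf
  rw [div_pow, h]
  field_simp

omit [Fintype m] [DecidableEq m] in
/-- ★ **Pointwise second-moment domination**: if at doubled coupling the normalised weight of every plaquette is bracketed
from above by a build plus tail, `e^{2b a_p}/c₂ ≤ u_p + τ′` (`PlaquetteCharacterTail.weight_mem_Icc_truncWeight` at `b ↦ 2b`),
then `Π_p (e^{b a_p}/c)² ≤ (c₂/c²)^{#s} · Π_p (u_p + τ′)` — the engine's `W² ≤ m₂^{N} · W′⁺(2β)` pointwise; the Loewner
statement `P D V V D P ⪯ m₂^N · (2β upper build)` used in `tailR_level_bound`'s `hdom` then follows from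
`GalerkinWeightMonotone.posSemidef_weightMatrix_sub`. [folklore] -/
theorem prod_sq_normWeight_le {ι : Type*} (s : Finset ι) (b c c₂ τ' : ℝ) (a u : ι → ℝ) (hc : 0 < c) (hc₂ : 0 < c₂)
    (hbr : ∀ p ∈ s, Real.exp (2 * b * a p) / c₂ ≤ u p + τ') :
    ∏ p ∈ s, (Real.exp (b * a p) / c) ^ 2 ≤ (c₂ / c ^ 2) ^ s.card * ∏ p ∈ s, (u p + τ') := by
  have hfac : ∀ p ∈ s, (Real.exp (b * a p) / c) ^ 2 = (c₂ / c ^ 2) * (Real.exp (2 * b * a p) / c₂) :=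
    fun p _ => sq_normWeight_eq b c c₂ (a p) hc.ne' hc₂.ne'
  rw [Finset.prod_congr rfl hfac, Finset.prod_mul_distrib, Finset.prod_const]
  refine mul_le_mul_of_nonneg_left ?_ (pow_nonneg (by positivity) _)
  exact Finset.prod_le_prod (fun p _ => by positivity) hbr

end RelativeKineticTail

end Summit.Ventures.YMGap.FlowData
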